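import Literature.AnabelianGeometry.EtaleTheta.Discharge.Sec2MonodromyModelHatScalingsStabilise
import HarnessLib

/-!
# [EtTh] Prop. 2.6, profinite clause, at the monodromy model — part 4a: STRUCTURE of the rotation closure `R` (TORSION-FREE) and of
# `A = cl(η Π^tp_{Ẋ̲}) = η⟨z⟩ · R` in `Π_C = (TG l)^∧` (proof-only)

S. Mochizuki, *The étale theta function and its Frobenioid-theoretic manifestations* [EtTh], Publ. RIMS **45** (2009), §2
Prop. 2.6, PDF p. 40, last sentence «A similar statement holds when "`Π^tp`" is replaced by "`Π`".»; Def. 2.5 (ii) p. 39; Rmk. 2.6.1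
p. 40 (`Aut_K` of the dotted members) [cite: MochizukiEtTh2009, Prop 2.6 p.40] [cite: MochizukiEtTh2009, Def 2.5(ii) p.39].
Cell abc-iut, block F, seat abc-iut-f-142 (gen 13), FACT-LIST row **F-0611** `TemperedCoverData.Prop26_profinite` — instance form at
abc-iut-w6-d084's monodromy model; sequel of parts 1–3 (`Sec2MonodromyModelHatRotationClosure`, `…HatScalings`, `…HatScalingsStabilise`).

WHAT IS PROVED (pure topological group theory about OUR carrier; `R = cl(η⟨t⟩)`, `z^c = embCu (c, 1)`, `ι` the inversion):
* `closed_subset_closure_eq_univ` (density, closed-set form), `exists_zpow_mem_of_isOpen` (every neighbourhood of `x ∈ R` contains a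
  power `η(t^k)` of the loop);
* **`eq_one_of_pow_eq_one_of_mem_rot` — `R` IS TORSION-FREE**: for each finite quotient `TG l/U` (index `N`) approximate `x ∈ R` by
  `η(t^k)` simultaneously in `TG l/U` and in `TG l/Ker(TG l ↠ D_{mN})` (components of Mathlib's limit `(TG l)^∧`); `x^m = 1` forces
  `N ∣ k`, so every component of `x` is trivial — i.e. the profinite topology induced on `⟨t⟩ ≅ ℤ` is the full one, proved without
  coordinatising `(TG l)^∧`;
* `toHat_zc_comm` (`η z^c` central), `zc_mul_rot_ne_mul_iotaM` (`Φ` separates `η z^c · R` from `η z^{c'} · R · η ι`);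
* coset description `mem_closure_dotXu_iff` (`A = η⟨z⟩ · R`; closure of a finite union of translates).
Sequel: part 4b `Sec2MonodromyModelHatDottedClosuresB.lean` (torsion and involutions in `A`, squares in `R`, `D = R ∪ R·ηι`,
`B = A ∪ A·ηι`), then parts 5–6 (the four extension theorems and `(monodromyModel l hl).Prop26_profinite`).

HONEST LABEL (abc-iut-L2-lead R1352, inherited from the carrier): «a DESIGNED tempered toy with print's monodromy combinatorics —
loop ↦ `Δ̄^ell` (`b`-cycle), the inversion INVERTS it, unipotent monodromy `x ↦ x·z` on the `a`-cycle, `z` = cusp inertia = `Δ̄_Θ`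
central; `G_K := 1`; NOT a Tate curve, NOT the tempered fundamental group of a curve; consistency ≠ faithfulness.» PROOF-ONLY
companion (0 `def`, 0 `instance`, 0 notation, 0 `Prop`-definition; nothing of abc-iut-w6-d084's model files or of abc-iut-L2-t2's
interface is edited or restated). Instance-at-OUR-carrier ≠ [EtTh] Prop. 2.6 for the profinite fundamental groups of a curve;
typed ≠ proved; no side is taken on [IUTchIII] Cor. 3.12 or on any author; nothing here asserts abc proved or refuted.
-/

noncomputable section

namespace Literature.AnabelianGeometry.EtaleTheta.ThetaCovers.MonodromyModel

open Multiplicative HeisenbergWitness TemperedModel DihedralGroup Topology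
open Literature.AnabelianGeometry.SemiGraphs

variable (l : ℕ)

/-! ## 1–4. Density and approximation; torsion; cosets; involutions and squares -/

section Structure

/-- A closed subset of `cl(M)` (as a subtype) that contains `M` is everything. (folklore; no claim about print)
[cite: MochizukiEtTh2009, §1 p.12] -/
theorem closed_subset_closure_eq_univ {H : Type*} [Group H] [TopologicalSpace H] [IsTopologicalGroup H]
    (M : Subgroup H) {P : Set ↥M.topologicalClosure} (hP : IsClosed P)
    (h : ∀ (x : H) (hx : x ∈ M), (⟨x, M.le_topologicalClosure hx⟩ : ↥M.topologicalClosure) ∈ P) (y : ↥M.topologicalClosure) :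
    y ∈ P := by
  set incl : M → ↥M.topologicalClosure := fun m => ⟨m, M.le_topologicalClosure m.2⟩ with hincl
  have himg : Subtype.val '' Set.range incl = (M : Set H) := by
    ext x
    constructor
    · rintro ⟨_, ⟨m, rfl⟩, rfl⟩
      exact m.2
    · intro hx
      exact ⟨⟨x, M.le_topologicalClosure hx⟩, ⟨⟨x, hx⟩, rfl⟩, rfl⟩
  have hd : DenseRange incl := by
    rw [DenseRange, dense_iff_closure_eq, IsEmbedding.subtypeVal.closure_eq_preimage_closure_image, himg]
    apply Set.eq_univ_of_forall
    rintro ⟨x, hx⟩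
    rw [Set.mem_preimage]
    change x ∈ closure (M : Set H)
    rwa [← Subgroup.topologicalClosure_coe]
  have hsub : Set.range incl ⊆ P := by
    rintro _ ⟨⟨x, hx⟩, rfl⟩
    exact h x hx
  have h2 := closure_minimal hsub hP
  rw [hd.closure_range] at h2
  exact h2 (Set.mem_univ y)

/-- **Approximation**: every open neighbourhood of `x ∈ R` contains some `η(t^k)`. (toy bookkeeping; no claim about print)
[cite: MochizukiEtTh2009, §1 p.12] -/
theorem exists_zpow_mem_of_isOpen {R : Subgroup (PiC l)}
    (hR : R = ((Subgroup.zpowers (embCu l (1, r 1))).map (toHat l).toMonoidHom).topologicalClosure)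
    {x : PiC l} (hx : x ∈ R) {O : Set (PiC l)} (hO : IsOpen O) (hxO : x ∈ O) :
    ∃ k : ℤ, toHat l (embCu l (1, r 1) ^ k) ∈ O := by
  have hx' : x ∈ closure (((Subgroup.zpowers (embCu l (1, r 1))).map (toHat l).toMonoidHom : Subgroup (PiC l)) : Set (PiC l)) := by
    rw [← Subgroup.topologicalClosure_coe, ← hR]; exact hx
  obtain ⟨y, hyO, hyS⟩ := mem_closure_iff.mp hx' O hO hxO
  obtain ⟨k, rfl⟩ := (mem_map_zpowers_iff l).mp hyS
  exact ⟨k, hyO⟩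

/-- **`R` is torsion-free** (`x ∈ R`, `x^m = 1`, `m ≥ 1` ⟹ `x = 1`). For each finite quotient `TG l/U` (index `N`), approximate `x`
by a power `η(t^k)` of the loop simultaneously in `TG l/U` and in the kernel-of-`D_{mN}` quotient: `x^m = 1` forces `N ∣ k`, so
the `U`-component of `x` is trivial (the profinite topology on `⟨t⟩ ≅ ℤ` induced from `TG l` is the full one). (toy bookkeeping;
no claim about print) [cite: MochizukiEtTh2009, §1 p.12] -/
theorem eq_one_of_pow_eq_one_of_mem_rot {R : Subgroup (PiC l)}
    (hR : R = ((Subgroup.zpowers (embCu l (1, r 1))).map (toHat l).toMonoidHom).topologicalClosure)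
    {x : PiC l} (hx : x ∈ R) {m : ℕ} (hm : m ≠ 0) (hxm : x ^ m = 1) : x = 1 := by
  refine ProfiniteGrp.limit_ext _ x 1 fun U => ?_
  set N := U.toSubgroup.index with hN
  have hN0 : N ≠ 0 := Subgroup.FiniteIndex.index_ne_zero
  haveI : NeZero (m * N) := ⟨mul_ne_zero hm hN0⟩
  have htN : embCu l (1, r 1) ^ (N : ℤ) ∈ U.toSubgroup := by
    rw [zpow_natCast]; exact Subgroup.pow_index_mem _ _
  -- `K :=` the kernel of `TG l ↠ D_∞ ↠ D_{mN}`
  let φ : TG l →* DihedralGroup (m * N) := (dihedralRed (m * N)).comp (TG.dih l)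
  let K : FiniteIndexNormalSubgroup (TG l) := FiniteIndexNormalSubgroup.ofSubgroup φ.ker
  have hφt : ∀ k : ℤ, φ (embCu l (1, r 1) ^ k) = r (k : ZMod (m * N)) := fun k => by
    change dihedralRed (m * N) (embCu l (1, r 1) ^ k).1.right = _
    rw [(t_zpow_coords l k).1, map_zpow, dihedralRed_r, map_one, r_one_zpow]
  -- approximate `x` simultaneously in the `U`- and `K`-components
  haveI : DiscreteTopology ((ProfiniteGrp.ProfiniteCompletion.diagram (GrpCat.of (TG l))).obj U) := ⟨rfl⟩
  haveI : DiscreteTopology ((ProfiniteGrp.ProfiniteCompletion.diagram (GrpCat.of (TG l))).obj K) := ⟨rfl⟩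
  have cU : Continuous (fun y : PiC l => y.val U) := (continuous_apply U).comp continuous_subtype_val
  have cK : Continuous (fun y : PiC l => y.val K) := (continuous_apply K).comp continuous_subtype_val
  have hO : IsOpen {y : PiC l | y.val U = x.val U ∧ y.val K = x.val K} :=
    ((isOpen_discrete ({x.val U} : Set _)).preimage cU).inter ((isOpen_discrete ({x.val K} : Set _)).preimage cK)
  obtain ⟨k, hkU, hkK⟩ := exists_zpow_mem_of_isOpen l hR hx hO ⟨rfl, rfl⟩
  -- `x^m = 1` in the `K`-component forces `N ∣ k`
  have h1 : (toHat l (embCu l (1, r 1) ^ k) ^ m).val K = 1 := by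
    change ((toHat l (embCu l (1, r 1) ^ k)).val K) ^ m = 1
    rw [hkK]
    change (x ^ m).val K = 1
    rw [hxm]
    rfl
  rw [← map_pow] at h1
  change (QuotientGroup.mk ((embCu l (1, r 1) ^ k) ^ m) : TG l ⧸ φ.ker) = 1 at h1
  rw [QuotientGroup.eq_one_iff, MonoidHom.mem_ker, ← zpow_natCast, ← zpow_mul, hφt, one_def] at h1
  have h2 : ((k * m : ℤ) : ZMod (m * N)) = 0 := r.inj h1
  rw [ZMod.intCast_zmod_eq_zero_iff_dvd] at h2
  have h3 : (N : ℤ) ∣ k := by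
    have h2' : ((m : ℤ) * N) ∣ m * k := by rw [mul_comm (m : ℤ) k]; exact_mod_cast h2
    exact Int.dvd_of_mul_dvd_mul_left (by exact_mod_cast hm) h2'
  obtain ⟨q, hq⟩ := h3
  -- hence `η(t^k) ∈ U` and the `U`-component of `x` is trivial
  rw [← hkU]
  change (QuotientGroup.mk (embCu l (1, r 1) ^ k) : TG l ⧸ U.toSubgroup) = 1
  rw [QuotientGroup.eq_one_iff, hq, zpow_mul]
  exact Subgroup.zpow_mem _ htN q

/-- `embCu (c, d) = embCu (c, 1) · embCu (1, d)`. (toy bookkeeping; no claim about print) [cite: MochizukiEtTh2009, Rmk 2.6.1 p.40] -/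
theorem embCu_eq_mul (c : Multiplicative (ZMod l)) (d : DihedralGroup 0) :
    embCu l (c, d) = embCu l (c, 1) * embCu l (1, d) := by
  rw [← map_mul, Prod.mk_mul_mk, mul_one, one_mul]

/-- Coordinates of `z^c = embCu (c, 1)`. (toy bookkeeping; no claim about print) [cite: MochizukiEtTh2009, Rmk 2.6.1 p.40] -/
@[simp] theorem zc_coords (c : Multiplicative (ZMod l)) :
    (embCu l (c, 1)).1.right = 1 ∧ bC l (embCu l (c, 1)) = 0 ∧ cC l (embCu l (c, 1)) = toAdd c ∧ (embCu l (c, 1)).2 = 1 :=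
  ⟨rfl, rfl, rfl, rfl⟩

/-- `z^c` is central in `TG l`. (toy bookkeeping for [EtTh] «`Δ̄_Θ` central»; no claim about print) [cite: MochizukiEtTh2009, Def 2.1 p.36] -/
theorem zc_comm (c : Multiplicative (ZMod l)) (g : TG l) : embCu l (c, 1) * g = g * embCu l (c, 1) :=
  TG.ext l (by simp) (by simp) (by simp; ring) (by simp)

/-- `η(z^c)` is central in `Π_C`. (toy bookkeeping; no claim about print) [cite: MochizukiEtTh2009, Def 2.1 p.36] -/
theorem toHat_zc_comm [NeZero l] (c : Multiplicative (ZMod l)) (y : PiC l) : toHat l (embCu l (c, 1)) * y = y * toHat l (embCu l (c, 1)) :=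
  (commute_of_denseRange (η := (toHat l).toMonoidHom) (ProfiniteGrp.ProfiniteCompletion.denseRange (G := GrpCat.of (TG l)))
    (toHat l (embCu l (c, 1))) (fun g => by
      change Commute (toHat l (embCu l (c, 1))) (toHat l g)
      rw [commute_iff_eq, ← map_mul, zc_comm, map_mul]) y).eq

/-- `Φ(η z^c · x)` is a rotation for `x ∈ R` (so `η z^c · x · η ι` is not of this form). (toy bookkeeping; no claim about print)
[cite: MochizukiEtTh2009, Prop 2.6 p.40] -/
theorem Phi_zc_mul_rot [NeZero l] {R : Subgroup (PiC l)}
    (hR : R = ((Subgroup.zpowers (embCu l (1, r 1))).map (toHat l).toMonoidHom).topologicalClosure)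
    (c : Multiplicative (ZMod l)) {x : PiC l} (hx : x ∈ R) :
    ∃ i : ZMod l, (Phi l (toHat l (embCu l (c, 1)) * x)).right = r i := by
  obtain ⟨i, hi⟩ := exists_Phi_eq_inr_r_of_mem_rot l hR hx
  refine ⟨i, ?_⟩
  rw [map_mul, SemidirectProduct.mul_right, hi, SemidirectProduct.right_inr, Phi_toHat, sh₀_right, embCu_right, map_one,
    one_mul]

/-- **No element of the form `η z^c · x · η ι` (`x ∈ R`) is of the form `η z^{c'} · x'` (`x' ∈ R`)** — their `Φ`-images are a
reflection resp. a rotation. (toy bookkeeping; no claim about print) [cite: MochizukiEtTh2009, Prop 2.6 p.40] -/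
theorem zc_mul_rot_ne_mul_iotaM [NeZero l] {R : Subgroup (PiC l)}
    (hR : R = ((Subgroup.zpowers (embCu l (1, r 1))).map (toHat l).toMonoidHom).topologicalClosure)
    (c c' : Multiplicative (ZMod l)) {x x' : PiC l} (hx : x ∈ R) (hx' : x' ∈ R) :
    toHat l (embCu l (c, 1)) * x ≠ toHat l (embCu l (c', 1)) * x' * iotaM l := by
  intro h
  obtain ⟨i, hi⟩ := Phi_zc_mul_rot l hR c hx
  obtain ⟨j, hj⟩ := Phi_zc_mul_rot l hR c' hx'
  have h2 := congrArg (fun y => (Phi l y).right) h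
  simp only [map_mul, SemidirectProduct.mul_right, Phi_iotaM, SemidirectProduct.right_inr] at h2
  rw [← SemidirectProduct.mul_right, ← map_mul, hi, ← SemidirectProduct.mul_right, ← map_mul, hj, r_mul_sr] at h2
  cases h2

/-- **Description of `A := cl(η Π^tp_{Ẋ̲})`** (`Π^tp_{Ẋ̲} = {b = 0, d rotation, e = 1} = ⟨z⟩ × ⟨t⟩`): `A = η⟨z⟩ · R`.
(toy bookkeeping for [EtTh] Def. 2.5 (ii) / Rmk. 2.6.1 «`Π_{Ẋ̲}`»; no claim about print) [cite: MochizukiEtTh2009, Def 2.5(ii) p.39] -/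
theorem mem_closure_dotXu_iff [NeZero l] {R : Subgroup (PiC l)}
    (hR : R = ((Subgroup.zpowers (embCu l (1, r 1))).map (toHat l).toMonoidHom).topologicalClosure)
    {A : Subgroup (PiC l)}
    (hA : A = (((heisB0 l ⊓ heisPiX l).comap (PhiT l) ⊓ PiCdotT l).map (toHat l).toMonoidHom).topologicalClosure) (y : PiC l) :
    y ∈ A ↔ ∃ c : Multiplicative (ZMod l), ∃ x ∈ R, y = toHat l (embCu l (c, 1)) * x := by
  have hRA : R ≤ A := by
    rw [hR, hA]
    refine Subgroup.topologicalClosure_mono (Subgroup.map_mono fun g hg => ?_)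
    obtain ⟨k, rfl⟩ := Subgroup.mem_zpowers_iff.mp hg
    rw [mem_dotXu_iff]
    exact ⟨0, k, ((embCu_one_dihedral l k).1).symm⟩
  constructor
  · intro hy
    -- the image set is a finite union of translates of `η⟨t⟩`
    have hset : ((((heisB0 l ⊓ heisPiX l).comap (PhiT l) ⊓ PiCdotT l).map (toHat l).toMonoidHom : Subgroup (PiC l)) :
        Set (PiC l)) ⊆ ⋃ c : Multiplicative (ZMod l), (Homeomorph.mulLeft (toHat l (embCu l (c, 1)))) ''
          (((Subgroup.zpowers (embCu l (1, r 1))).map (toHat l).toMonoidHom : Subgroup (PiC l)) : Set (PiC l)) := by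
      rintro _ ⟨g, hg, rfl⟩
      obtain ⟨c, j, rfl⟩ := (mem_dotXu_iff l g).mp hg
      refine Set.mem_iUnion.mpr ⟨ofAdd c, toHat l (embCu l (1, r 1) ^ (show ℤ from j)),
        (mem_map_zpowers_iff l).mpr ⟨_, rfl⟩, ?_⟩
      change toHat l (embCu l (ofAdd c, 1)) * _ = _
      rw [← map_mul, ← (embCu_one_dihedral l j).1, ← embCu_eq_mul]
      rfl
    have hy' : y ∈ closure ((((heisB0 l ⊓ heisPiX l).comap (PhiT l) ⊓ PiCdotT l).map (toHat l).toMonoidHom :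
        Subgroup (PiC l)) : Set (PiC l)) := by
      rw [← Subgroup.topologicalClosure_coe, ← hA]; exact hy
    have hy2 := closure_mono hset hy'
    rw [closure_iUnion_of_finite] at hy2
    obtain ⟨c, hc⟩ := Set.mem_iUnion.mp hy2
    rw [← Homeomorph.image_closure, ← Subgroup.topologicalClosure_coe, ← hR] at hc
    obtain ⟨x, hx, rfl⟩ := hc
    exact ⟨c, x, hx, rfl⟩
  · rintro ⟨c, x, hx, rfl⟩
    refine A.mul_mem ?_ (hRA hx)
    rw [hA]
    exact Subgroup.le_topologicalClosure _ ⟨_, (mem_dotXu_iff l _).mpr ⟨toAdd c, 0, by rw [ofAdd_toAdd]; rfl⟩, rfl⟩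

end Structure

end Literature.AnabelianGeometry.EtaleTheta.ThetaCovers.MonodromyModel

end
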